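import Summits.BirchSwinnertonDyer.BirchSwinnertonDyer.Theorems.EisensteinPrimesFullDescentSplittingPrime
import Summits.BirchSwinnertonDyer.BirchSwinnertonDyer.Theorems.EisensteinPrimesFullDescentKummerSplitting
import Literature.NumberTheory.EllipticCurves.MazurTorsionHerbrandProofs
import Literature.NumberTheory.GaloisRepresentations.DecompositionGroupOfCompletion
import Literature.NumberTheory.GaloisRepresentations.IntegralGaloisActionProofs
import Literature.NumberTheory.GaloisRepresentations.RamificationFiltrationProofs
import HarnessLib

/-!
# Crux `GoodLatticeBDPValue` (stmt-BirchSwinnertonDyer-19032), line `halves`, road R5 / AN-5 (the `5 ≤ p` twin of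
# Theorem T′) — brick HS-2: **the HERBRAND splitting lemma** — an extension `0 → 𝟙 → X → μ_p → 0` of `Γ_ℚ`-modules
# (`p` ANY odd prime) that is inertia-trivial at every prime `≠ p` and split at the decomposition group of `p` SPLITS
# (KERNEL: Mazur 1977 III §5 (R3) = Herbrand `A(ω⁻¹) = 0`, a tree theorem; no Kummer theory, no named fact)

Width seat bsd-line-x1-p1-w7 (gen 7; `--supports -19032`, closes nothing by itself). Cell `bsd-eis`
(`run/shared/lean/pub/bsd-eis/`), road R5 (HOME STATUS 2026-08-28 21:34Z): the `5 ≤ p` twin T‴ of the kernel theorem T′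
(`GoodLatticeBDPValueFullDescentStub.stub_fullDescentAtThreeOfRed`, p658450) along w3 gen 4's elementary road
(`HOME/line-x1-p1-w3-g4/AN3-StubB-elementary-road.md`) at level `p`/`p²`. THIS FILE is the `p`-version of w2 gen 5's
`FullDescentKummerSplitting.exists_stable_complement` (p654936), SAME INTERFACE with `(3, 9, v₃) ↦ (p, p², v₀)`:
`V` a `Γ_ℚ`-module, `L ≤ N ≤ M ≤ V` with `#N = p·#L`, `#M = p²·#L`, `pM ≤ L`, `L` stable, `Γ_ℚ` trivial on `N/L` and acting
through the mod `p` cyclotomic character `χ̄_p` on `M/N`; HYPOTHESES: stabilisers open, one inertia group above every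
`v ∤ p` trivial on `M/L`, and a `D_p`-stable `B₀` with `L ≤ B₀ ≤ M`, `#B₀ = p·#L`, `B₀ ⊓ N = L` (`D_p =
GreenbergSelmer.decomp v₀`, the decomposition group of the tree's chosen prime above `p`); CONCLUSION: a `Γ_ℚ`-stable `B`
with `L ≤ B ≤ M`, `B ⊓ N = L`, `N ⊔ B = M`.

PROOF. With `a₀ ∈ N ∖ L`, `b₀ ∈ B₀ ∖ L`, `σ b₀ ≡ e_σ b₀ + n_σ a₀ (mod L)` (`e_σ` the representative of `χ̄_p(σ)`), the
abstract splitting lemma HS-1 (`FullDescentSplittingPrime.exists_stable_complement_mod`, this seat) reduces everything to its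
arithmetic input `hGK`: a map `b : Γ_ℚ → ℤ/p`, additive on `ker χ̄_p`, `χ̄_p⁻¹`-equivariant under conjugation, vanishing on the
(open) stabiliser of `b₀`, on one inertia group above every `v ∤ p` and on `D_p`, vanishes on `ker χ̄_p`. That is EXACTLY
`Literature.NumberTheory.EllipticCurves.Mazur1977_herbrand` (Mazur 1977 III §5 (R3): «an everywhere unramified `p`-cyclic
extension of `ℚ(ζ_p)`, Galois over `ℚ`, on whose group `Gal(ℚ(ζ_p)/ℚ)` acts through `χ⁻¹`, is trivial» — Herbrand's
`A(ω^{p−2}) = 0` from `p ∤ B₂ = 1/6`, PROVED in the tree from Stickelberger's theorem and the tree's class field theory)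
once the one-prime-per-place data are transported to ALL primes above each place by conjugation (`I_{σ𝔓} = σ I_𝔓 σ⁻¹`,
`Ideal.inertia_smul`; transitivity `HeightOneSpectrum.exists_smul_eq_of_mem_primesAbove_holds`; at `p`:
`I_{𝔓₀} ≤ D_{𝔓₀} = D_p`, `decompositionSubgroup_adicCompletionPrime_eq_range`).

* §1 index-`p` bookkeeping (`exists_zsmul_sub_mem_of_card`, `prime_dvd_of_zsmul_mem`, `exists_mem_not_mem_of_card` — w2's
  `FullDescentKummerModule` lemmas with `3 ↦ p`);
* §2 `forall_primesAbove_of_inertia_of_conj` — the conjugation transport of «`b` kills `I_𝔓 ∩ ker χ̄_p`» from one prime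
  above `v` to all of them;
* §3 **`exists_stable_complement`** — the splitting lemma.

HONEST FRAMING: helper theorems only (0 definitions, 0 named facts, 0 sorry); no summit statement, no BSD / IMC2 /
Keller–Yin theorem, no stub of the registered skeleton is proved here. References: [Mazur1977] B. Mazur, *Modular curves
and the Eisenstein ideal*, Publ. Math. IHÉS 47 (1977), Ch. I §2 (2.8)–(2.9), Ch. III §5 p. 158; [Washington1997] §6.3
Thm. 6.17 (Herbrand); [SerreLocalFields1979] Ch. VII §§1–2; [NeukirchANT1999] Ch. I §9 (9.1), (9.5)–(9.6), Ch. II §9 (9.6).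
-/

set_option autoImplicit false
-- the route's Theorems namespace repeats the summit name by design (D-0017 nested layout)
set_option linter.dupNamespace false

noncomputable section

open scoped Classical NumberField Pointwise

namespace Summit.BirchSwinnertonDyer.BirchSwinnertonDyer.Theorems.FullDescentHerbrandSplitting

open Function NumberField IsDedekindDomain Field Rat.HeightOneSpectrum
  Literature.NumberTheory.GaloisRepresentations Literature.NumberTheory.EllipticCurves

/-! ## §1. Index-`p` subgroups -/

section Module

variable {V : Type*} [AddCommGroup V] {p : ℕ} [hp : Fact p.Prime]

/-- **An index-`p` subgroup is `L + ℤa` for any `a ∈ N ∖ L`**: if `L ≤ N` with `#N = p·#L` (finite) and `a ∈ N`,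
`a ∉ L`, then every `y ∈ N` is `≡ k a (mod L)` for some `k ∈ ℤ` (the quotient `N/L` has prime order `p`, so any non-zero
class generates it, Mathlib `mem_zmultiples_of_prime_card`). [folklore] -/
theorem exists_zsmul_sub_mem_of_card {L N : AddSubgroup V} (hLN : L ≤ N) {c : ℕ} (hc : c ≠ 0)
    (hcL : Nat.card L = c) (hcN : Nat.card N = p * c) {a : V} (haN : a ∈ N) (haL : a ∉ L) :
    ∀ y ∈ N, ∃ k : ℤ, y - k • a ∈ L := by
  intro y hy
  set H : AddSubgroup N := L.addSubgroupOf N with hH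
  have hcardH : Nat.card H = c := by
    rw [hH, Nat.card_congr (AddSubgroup.addSubgroupOfEquivOfLe hLN).toEquiv, hcL]
  have hindex : H.index = p := by
    have h := H.card_mul_index
    rw [hcardH, hcN] at h
    have : c * H.index = c * p := by linarith
    exact Nat.eq_of_mul_eq_mul_left (Nat.pos_of_ne_zero hc) this
  have hcardQ : Nat.card (N ⧸ H) = p := by rw [← AddSubgroup.index_eq_card, hindex]
  have ha0 : (QuotientAddGroup.mk (⟨a, haN⟩ : N) : N ⧸ H) ≠ 0 := by
    intro h
    rw [QuotientAddGroup.eq_zero_iff, hH, AddSubgroup.mem_addSubgroupOf] at h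
    exact haL h
  have hmem := mem_zmultiples_of_prime_card hcardQ ha0 (g' := (QuotientAddGroup.mk (⟨y, hy⟩ : N) : N ⧸ H))
  rw [AddSubgroup.mem_zmultiples_iff] at hmem
  obtain ⟨k, hk⟩ := hmem
  refine ⟨k, ?_⟩
  rw [← QuotientAddGroup.mk_zsmul, QuotientAddGroup.eq, hH, AddSubgroup.mem_addSubgroupOf] at hk
  have : ((-(k • (⟨a, haN⟩ : N)) + ⟨y, hy⟩ : N) : V) = y - k • a := by
    simp only [AddSubgroup.coe_add, AddSubgroup.coe_neg, AddSubgroupClass.coe_zsmul]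
    abel
  rw [this] at hk
  exact hk

omit hp in
/-- **`p ∣ j` from `jx ∈ P`** when `px ∈ P` but `x ∉ P`, `p` prime (Bezout: otherwise `gcd(p, j) = 1` and `x ∈ P`).
[folklore] -/
theorem prime_dvd_of_zsmul_mem (hp' : p.Prime) {P : AddSubgroup V} {x : V} (hpx : (p : ℤ) • x ∈ P) (hx : x ∉ P)
    {j : ℤ} (hj : j • x ∈ P) : (p : ℤ) ∣ j := by
  by_contra h
  have hcop : IsCoprime (p : ℤ) j := (Nat.prime_iff_prime_int.mp hp').coprime_iff_not_dvd.mpr h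
  obtain ⟨u, w, huw⟩ := hcop
  apply hx
  have : x = u • ((p : ℤ) • x) + w • (j • x) := by
    rw [smul_smul, smul_smul, ← add_smul, huw, one_smul]
  rw [this]
  exact P.add_mem (P.zsmul_mem hpx u) (P.zsmul_mem hj w)

/-- There is an element of `N` outside `L` when `#N = p·#L ≠ 0`, `p` prime. [folklore] -/
theorem exists_mem_not_mem_of_card {L N : AddSubgroup V} (hLN : L ≤ N) {c : ℕ} (hc : c ≠ 0)
    (hcL : Nat.card L = c) (hcN : Nat.card N = p * c) : ∃ a ∈ N, a ∉ L := by
  by_contra h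
  push Not at h
  have hNL : N = L := le_antisymm (fun x hx ↦ h x hx) hLN
  have h1 : Nat.card N = Nat.card L := by rw [hNL]
  rw [hcL, hcN] at h1
  have h2 : p * c = 1 * c := by rw [h1, one_mul]
  exact hp.out.one_lt.ne' (Nat.eq_of_mul_eq_mul_right (Nat.pos_of_ne_zero hc) h2)

end Module

/-! ## §2. Transport of «`b` kills `I_𝔓 ∩ ker χ̄_p`» to all primes above a place -/

/-- **Conjugation transport.** For a `χ̄_p⁻¹`-equivariant map `b : Γ_ℚ → ℤ/p` (Mazur's `hconj`), if `b` kills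
`I_{𝔓₀} ∩ ker χ̄_p` for ONE prime `𝔓₀` of `ℤ̄` above the place `v`, then it kills `I_𝔓 ∩ ker χ̄_p` for EVERY prime `𝔓`
above `v`: `𝔓 = σ𝔓₀` (transitivity, `HeightOneSpectrum.exists_smul_eq_of_mem_primesAbove_holds`), `I_{σ𝔓₀} = σ I_{𝔓₀} σ⁻¹`
(`Ideal.inertia_smul`), and `b(στσ⁻¹) = χ̄_p(σ)⁻¹ b(τ)`. [cite: NeukirchANT1999, Ch. I §9 Prop. (9.1) and (9.5)–(9.6)] -/
theorem forall_primesAbove_of_inertia_of_conj {p : ℕ} [Fact p.Prime] {v : HeightOneSpectrum (𝓞 ℚ)}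
    {𝔓₀ : Ideal (absIntegers (𝓞 ℚ) ℚ)} (h𝔓₀ : 𝔓₀ ∈ v.primesAbove) (b : absoluteGaloisGroup ℚ → ZMod p)
    (hconj : ∀ g σ : absoluteGaloisGroup ℚ, modNCyclotomicCharacter ℚ p σ = 1 →
      b (g * σ * g⁻¹) = (((modNCyclotomicCharacter ℚ p g)⁻¹ : (ZMod p)ˣ) : ZMod p) * b σ)
    (h0 : ∀ τ ∈ 𝔓₀.inertia (absoluteGaloisGroup ℚ), modNCyclotomicCharacter ℚ p τ = 1 → b τ = 0) :
    ∀ 𝔓 ∈ v.primesAbove, ∀ τ ∈ 𝔓.inertia (absoluteGaloisGroup ℚ), modNCyclotomicCharacter ℚ p τ = 1 → b τ = 0 := by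
  intro 𝔓 h𝔓 τ hτ hτ1
  obtain ⟨σ, rfl⟩ := HeightOneSpectrum.exists_smul_eq_of_mem_primesAbove_holds (K := ℚ) (v := v) h𝔓₀ h𝔓
  rw [Ideal.inertia_smul 𝔓₀ (absoluteGaloisGroup ℚ) σ, Subgroup.mem_pointwise_smul_iff_inv_smul_mem] at hτ
  -- `τ₀ = σ⁻¹ τ σ ∈ I_{𝔓₀}`
  set τ₀ : absoluteGaloisGroup ℚ := (MulAut.conj σ)⁻¹ • τ with hτ₀
  have hτ₀' : τ₀ = σ⁻¹ * τ * σ := by rw [hτ₀, MulAut.smul_def, MulAut.conj_inv_apply]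
  have hττ₀ : τ = σ * τ₀ * σ⁻¹ := by rw [hτ₀']; group
  have hτ₀1 : modNCyclotomicCharacter ℚ p τ₀ = 1 := by
    rw [hτ₀', map_mul, map_mul, map_inv, hτ1, mul_one, inv_mul_cancel]
  rw [hττ₀, hconj σ τ₀ hτ₀1, h0 τ₀ hτ hτ₀1, mul_zero]

/-! ## §3. The splitting lemma -/

/-- **The Herbrand splitting lemma for `0 → 𝟙 → X → μ_p → 0` over `Γ_ℚ`, `p` an odd prime** (relative form, see the
module docstring). `V` a `Γ_ℚ`-module, `L ≤ N ≤ M ≤ V` with `#L = c ≠ 0`, `#N = p c`, `#M = p² c`, `pM ≤ L`, `L` stable,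
`Γ_ℚ` trivial on `N/L` and `≡ χ̄_p` on `M/N`, stabilisers of the elements of `M` open; if for every finite place `v ∤ p`
SOME inertia group above `v` is trivial on `M/L`, and at the place `v₀ ∣ p` some `B₀` with `L ≤ B₀ ≤ M`, `#B₀ = p c`,
`B₀ ⊓ N = L` is stable under the decomposition group `GreenbergSelmer.decomp v₀`, then there is a `Γ_ℚ`-STABLE `B` with
`L ≤ B ≤ M`, `B ⊓ N = L`, `N ⊔ B = M`. The arithmetic input is `Literature.NumberTheory.EllipticCurves.Mazur1977_herbrand`
(Herbrand `A(ω⁻¹) = 0`), fed through the abstract lemma `FullDescentSplittingPrime.exists_stable_complement_mod`.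
[cite: Mazur1977, Ch. I §2 Prop. (2.8)–Cor. (2.9) and Ch. III §5 p. 158] [cite: Washington1997, §6.3 Thm. 6.17]
[cite: SerreLocalFields1979, Ch. VII §1–§2] -/
theorem exists_stable_complement {V : Type*} [AddCommGroup V] [DistribMulAction (absoluteGaloisGroup ℚ) V]
    {p : ℕ} [hp : Fact p.Prime] (hp2 : p ≠ 2)
    (L N M : AddSubgroup V) (hLN : L ≤ N) (hNM : N ≤ M) {c : ℕ} (hc : c ≠ 0)
    (hcL : Nat.card L = c) (hcN : Nat.card N = p * c) (hcM : Nat.card M = p ^ 2 * c)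
    (hL : ∀ (σ : absoluteGaloisGroup ℚ), ∀ x ∈ L, σ • x ∈ L)
    (hpM : ∀ x ∈ M, (p : ℤ) • x ∈ L)
    (hA : ∀ (σ : absoluteGaloisGroup ℚ), ∀ x ∈ N, σ • x - x ∈ L)
    (hω : ∀ (σ : absoluteGaloisGroup ℚ), ∀ x ∈ M,
      σ • x - (((modNCyclotomicCharacter ℚ p σ : (ZMod p)ˣ) : ZMod p).val : ℤ) • x ∈ N)
    (hcont : ∀ x ∈ M, IsOpen ((MulAction.stabilizer (absoluteGaloisGroup ℚ) x : Subgroup (absoluteGaloisGroup ℚ)) :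
      Set (absoluteGaloisGroup ℚ)))
    (hunr : ∀ v : HeightOneSpectrum (𝓞 ℚ), natGenerator v ≠ p →
      ∃ 𝔓 ∈ v.primesAbove, ∀ τ ∈ 𝔓.inertia (absoluteGaloisGroup ℚ), ∀ x ∈ M, τ • x - x ∈ L)
    {v₀ : HeightOneSpectrum (𝓞 ℚ)} (hv₀ : natGenerator v₀ = p)
    (hspl : ∃ B₀ : AddSubgroup V, L ≤ B₀ ∧ B₀ ≤ M ∧ Nat.card B₀ = p * c ∧ B₀ ⊓ N = L ∧
      ∀ δ ∈ GreenbergSelmer.decomp (K := ℚ) v₀, ∀ x ∈ B₀, δ • x ∈ B₀) :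
    ∃ B : AddSubgroup V, L ≤ B ∧ B ≤ M ∧ B ⊓ N = L ∧ N ⊔ B = M ∧
      ∀ (σ : absoluteGaloisGroup ℚ), ∀ x ∈ B, σ • x ∈ B := by
  have hpp : p.Prime := hp.out
  -- ### notation: the character `χ` and its representative `e σ`
  set χ : absoluteGaloisGroup ℚ →* (ZMod p)ˣ := modNCyclotomicCharacter ℚ p with hχ
  set e : absoluteGaloisGroup ℚ → ℤ := fun σ ↦ (((χ σ : (ZMod p)ˣ) : ZMod p).val : ℤ) with he
  -- `σ` commutes with integer multiples
  have hσz : ∀ (σ : absoluteGaloisGroup ℚ) (k : ℤ) (x : V), σ • (k • x) = k • (σ • x) := fun σ k x ↦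
    map_zsmul (DistribSMul.toAddMonoidHom V σ) k x
  -- ### the two generators `a₀ ∈ N ∖ L`, `b₀ ∈ B₀ ∖ L`
  obtain ⟨a₀, ha₀N, ha₀L⟩ := exists_mem_not_mem_of_card (p := p) hLN hc hcL hcN
  have ha₀M : a₀ ∈ M := hNM ha₀N
  obtain ⟨B₀, hLB₀, hB₀M, hcB₀, hB₀N, hB₀stab⟩ := hspl
  obtain ⟨b₀, hb₀B₀, hb₀L⟩ := exists_mem_not_mem_of_card (p := p) hLB₀ hc hcL hcB₀
  have hb₀M : b₀ ∈ M := hB₀M hb₀B₀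
  have hb₀N : b₀ ∉ N := fun h ↦ hb₀L (by rw [← hB₀N]; exact ⟨hb₀B₀, h⟩)
  have hpc : p * c ≠ 0 := mul_ne_zero hpp.ne_zero hc
  have genN : ∀ y ∈ N, ∃ k : ℤ, y - k • a₀ ∈ L := exists_zsmul_sub_mem_of_card (p := p) hLN hc hcL hcN ha₀N ha₀L
  have genM : ∀ x ∈ M, ∃ j : ℤ, x - j • b₀ ∈ N :=
    exists_zsmul_sub_mem_of_card (p := p) hNM hpc hcN (by rw [hcM]; ring) hb₀M hb₀N
  have hpb₀ : (p : ℤ) • b₀ ∈ L := hpM b₀ hb₀M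
  have hpa₀ : (p : ℤ) • a₀ ∈ L := hpM a₀ ha₀M
  -- multiples by a multiple of `p` land in `L`
  have hLmul : ∀ {x : V} {k : ℤ}, (p : ℤ) • x ∈ L → (p : ℤ) ∣ k → k • x ∈ L := by
    rintro x k hx ⟨k', rfl⟩
    rw [mul_comm, mul_smul]
    exact L.zsmul_mem hx k'
  -- ### uniqueness of coordinates modulo `L`
  have U : ∀ i j : ℤ, i • a₀ + j • b₀ ∈ L → (p : ℤ) ∣ i ∧ (p : ℤ) ∣ j := by
    intro i j hij
    have hjN : j • b₀ ∈ N := by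
      have : j • b₀ = (i • a₀ + j • b₀) - i • a₀ := by abel
      rw [this]
      exact N.sub_mem (hLN hij) (N.zsmul_mem ha₀N i)
    have hj : (p : ℤ) ∣ j := prime_dvd_of_zsmul_mem hpp (hLN hpb₀) hb₀N hjN
    have hiL : i • a₀ ∈ L := by
      have : i • a₀ = (i • a₀ + j • b₀) - j • b₀ := by abel
      rw [this]
      exact L.sub_mem hij (hLmul hpb₀ hj)
    exact ⟨prime_dvd_of_zsmul_mem hpp hpa₀ ha₀L hiL, hj⟩
  have hind : ∀ i j : ℤ, i • a₀ + j • b₀ ∈ L ↔ (p : ℤ) ∣ i ∧ (p : ℤ) ∣ j :=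
    fun i j ↦ ⟨U i j, fun ⟨hi, hj⟩ ↦ L.add_mem (hLmul hpa₀ hi) (hLmul hpb₀ hj)⟩
  -- ### the coefficient `n σ`: `σ b₀ ≡ e σ • b₀ + n σ • a₀ (mod L)`
  have hn' : ∀ σ : absoluteGaloisGroup ℚ, ∃ k : ℤ, (σ • b₀ - e σ • b₀) - k • a₀ ∈ L := fun σ ↦
    genN _ (hω σ b₀ hb₀M)
  choose n hn using hn'
  have hQ : ∀ σ : absoluteGaloisGroup ℚ, σ • b₀ - (e σ • b₀ + n σ • a₀) ∈ L := fun σ ↦ by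
    rw [← sub_sub]; exact hn σ
  -- ### the families of subgroups: inertia above `v ∤ p` (one prime per place) and the stabiliser of `b₀`; `D_p`
  let 𝔓c : {v : HeightOneSpectrum (𝓞 ℚ) // natGenerator v ≠ p} → Ideal (absIntegers (𝓞 ℚ) ℚ) :=
    fun v ↦ Classical.choose (hunr v.1 v.2)
  have h𝔓c : ∀ v : {v : HeightOneSpectrum (𝓞 ℚ) // natGenerator v ≠ p},
      𝔓c v ∈ v.1.primesAbove ∧ ∀ τ ∈ (𝔓c v).inertia (absoluteGaloisGroup ℚ), ∀ x ∈ M, τ • x - x ∈ L :=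
    fun v ↦ Classical.choose_spec (hunr v.1 v.2)
  let I : {v : HeightOneSpectrum (𝓞 ℚ) // natGenerator v ≠ p} ⊕ Unit → Subgroup (absoluteGaloisGroup ℚ) :=
    fun j ↦ match j with
      | Sum.inl v => (𝔓c v).inertia (absoluteGaloisGroup ℚ)
      | Sum.inr _ => MulAction.stabilizer (absoluteGaloisGroup ℚ) b₀
  let D : Unit → Subgroup (absoluteGaloisGroup ℚ) := fun _ ↦ GreenbergSelmer.decomp (K := ℚ) v₀
  have hI : ∀ j, ∀ σ ∈ I j, σ • b₀ - b₀ ∈ L := by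
    rintro (v | u) σ hσ
    · exact (h𝔓c v).2 σ hσ b₀ hb₀M
    · have hσb : σ • b₀ = b₀ := hσ
      rw [hσb, sub_self]; exact L.zero_mem
  have hD : ∀ k, ∃ Λ : AddSubgroup V, (∀ σ ∈ D k, ∀ x ∈ Λ, σ • x ∈ Λ) ∧
      (∃ x ∈ Λ, ∃ a : ℤ, x - (b₀ + a • a₀) ∈ L) ∧ (∀ x ∈ Λ, ∀ b : ℤ, x - b • a₀ ∈ L → (p : ℤ) ∣ b) := by
    intro _
    refine ⟨B₀, hB₀stab, ⟨b₀, hb₀B₀, 0, by rw [zero_smul, add_zero, sub_self]; exact L.zero_mem⟩, ?_⟩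
    intro x hx b hxb
    have hbB₀ : b • a₀ ∈ B₀ := by
      have : b • a₀ = x - (x - b • a₀) := by abel
      rw [this]; exact B₀.sub_mem hx (hLB₀ hxb)
    have hbL : b • a₀ ∈ L := by rw [← hB₀N]; exact ⟨hbB₀, N.zsmul_mem ha₀N b⟩
    exact prime_dvd_of_zsmul_mem hpp hpa₀ ha₀L hbL
  -- ### the arithmetic input: Herbrand (Mazur 1977 (R3))
  have hGK : ∀ b : absoluteGaloisGroup ℚ → ZMod p,
      (∀ σ τ : absoluteGaloisGroup ℚ, χ σ = 1 → χ τ = 1 → b (σ * τ) = b σ + b τ) →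
      (∀ g σ : absoluteGaloisGroup ℚ, χ σ = 1 → b (g * σ * g⁻¹) = (((χ g)⁻¹ : (ZMod p)ˣ) : ZMod p) * b σ) →
      (∀ j, ∀ σ ∈ I j, χ σ = 1 → b σ = 0) →
      (∀ k, ∀ σ ∈ D k, χ σ = 1 → b σ = 0) →
      ∀ σ : absoluteGaloisGroup ℚ, χ σ = 1 → b σ = 0 := by
    intro b hmul hconj hbI hbD
    refine Mazur1977_herbrand (N := p) hp2 b hmul hconj ?_ ?_
    · -- local constancy: `b` vanishes on the open stabiliser of `b₀`
      exact ⟨MulAction.stabilizer (absoluteGaloisGroup ℚ) b₀, hcont b₀ hb₀M, Subgroup.one_mem _,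
        fun σ hσ h1 ↦ hbI (Sum.inr ()) σ hσ h1⟩
    · -- every inertia group at every place
      intro v 𝔓 h𝔓 τ hτ hτ1
      by_cases hv : natGenerator v = p
      · -- the place of `p`: `I_𝔓` is conjugate to `I_{𝔓₀} ≤ D_{𝔓₀} = D_p`
        have hvv₀ : v = v₀ := by
          apply Rat.HeightOneSpectrum.primesEquiv.injective
          apply Subtype.ext
          change natGenerator v = natGenerator v₀
          rw [hv, hv₀]
        subst hvv₀
        refine forall_primesAbove_of_inertia_of_conj (adicCompletionPrime_mem_primesAbove ℚ v) b hconj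
          (fun τ' hτ' hτ'1 ↦ hbD () τ' ?_ hτ'1) 𝔓 h𝔓 τ hτ hτ1
        have hD' := Ideal.inertia_le_decompositionSubgroup (absoluteGaloisGroup ℚ) (adicCompletionPrime ℚ v) hτ'
        rw [decompositionSubgroup_adicCompletionPrime_eq_range] at hD'
        exact hD'
      · exact forall_primesAbove_of_inertia_of_conj (h𝔓c ⟨v, hv⟩).1 b hconj
          (fun τ' hτ' hτ'1 ↦ hbI (Sum.inl ⟨v, hv⟩) τ' hτ' hτ'1) 𝔓 h𝔓 τ hτ hτ1
  -- ### the abstract splitting lemma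
  obtain ⟨a, ha⟩ := FullDescentSplittingPrime.exists_stable_complement_mod (p := p) hL χ (c := n)
    (fun σ ↦ hA σ a₀ ha₀N) hQ hind I D hI hD hGK
  -- ### the complement: `b₁ = b₀ + a a₀`, `B = L + ℤ b₁`
  set b₁ : V := b₀ + a • a₀ with hb₁
  have hb₁M : b₁ ∈ M := M.add_mem hb₀M (M.zsmul_mem ha₀M _)
  have hpb₁ : (p : ℤ) • b₁ ∈ L := hpM b₁ hb₁M
  -- `σ b₁ ≡ e σ b₁ (mod L)`
  have hb₁σ : ∀ σ : absoluteGaloisGroup ℚ, σ • b₁ - e σ • b₁ ∈ L := fun σ ↦ ha σ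
  -- ### the complement `B = L + ℤ b₁`
  refine ⟨L ⊔ AddSubgroup.zmultiples b₁, le_sup_left,
    sup_le (hLN.trans hNM) (AddSubgroup.zmultiples_le.mpr hb₁M), ?_, ?_, ?_⟩
  · -- `B ⊓ N = L`
    refine le_antisymm ?_ (le_inf le_sup_left hLN)
    rintro x ⟨hxB, hxN⟩
    obtain ⟨y, hy, z, hz, rfl⟩ := AddSubgroup.mem_sup.mp hxB
    obtain ⟨k, rfl⟩ := AddSubgroup.mem_zmultiples_iff.mp hz
    have hkN : k • b₁ ∈ N := by
      have : k • b₁ = (y + k • b₁) - y := by abel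
      rw [this]
      exact N.sub_mem hxN (hLN hy)
    have hkb₀ : k • b₀ ∈ N := by
      have : k • b₀ = k • b₁ - (k * a) • a₀ := by rw [hb₁, smul_add, mul_smul]; abel
      rw [this]
      exact N.sub_mem hkN (N.zsmul_mem ha₀N _)
    have hk : (p : ℤ) ∣ k := prime_dvd_of_zsmul_mem hpp (hLN hpb₀) hb₀N hkb₀
    exact L.add_mem hy (hLmul hpb₁ hk)
  · -- `N ⊔ B = M`
    refine le_antisymm (sup_le hNM (sup_le (hLN.trans hNM) (AddSubgroup.zmultiples_le.mpr hb₁M))) ?_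
    intro x hx
    obtain ⟨j', hj'⟩ := genM x hx
    have hxN : x - j' • b₁ ∈ N := by
      have : x - j' • b₁ = (x - j' • b₀) - (j' * a) • a₀ := by rw [hb₁, smul_add, mul_smul]; abel
      rw [this]
      exact N.sub_mem hj' (N.zsmul_mem ha₀N _)
    exact AddSubgroup.mem_sup.mpr ⟨x - j' • b₁, hxN, j' • b₁,
      AddSubgroup.mem_sup_right (AddSubgroup.mem_zmultiples_iff.mpr ⟨j', rfl⟩), by abel⟩
  · -- `Γ_ℚ`-stability
    intro σ x hx
    obtain ⟨y, hy, z, hz, rfl⟩ := AddSubgroup.mem_sup.mp hx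
    obtain ⟨k, rfl⟩ := AddSubgroup.mem_zmultiples_iff.mp hz
    have key : σ • (y + k • b₁) = σ • y + k • (σ • b₁) := by rw [smul_add, hσz]
    have : σ • y + k • (σ • b₁) = (σ • y + k • (σ • b₁ - e σ • b₁)) + (k * e σ) • b₁ := by
      generalize σ • y = u
      generalize σ • b₁ = w
      module
    rw [key, this]
    exact AddSubgroup.mem_sup.mpr ⟨σ • y + k • (σ • b₁ - e σ • b₁),
      L.add_mem (hL σ y hy) (L.zsmul_mem (hb₁σ σ) _), (k * e σ) • b₁,
      AddSubgroup.mem_zmultiples_iff.mpr ⟨k * e σ, rfl⟩, rfl⟩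

end Summit.BirchSwinnertonDyer.BirchSwinnertonDyer.Theorems.FullDescentHerbrandSplitting

end
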